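import Summits.HodgeConjecture.HodgeConjecture.Theorems.VHCAbelianSchemesRoadSigmaTransferDerivedLiftingDatum
import Literature.AlgebraicGeometry.Morphisms.ProperCoherentCohomologyFinite
import Literature.AlgebraicGeometry.Morphisms.CohOfVectorBundle
import Literature.AlgebraicGeometry.Crystalline.HodgeSheavesTorsionFree
import Literature.AlgebraicGeometry.Motives.AbelianVarietyProofs
import HarnessLib

/-!
# Road №4 (`VHCAbelianSchemesRoad`) — (c1Tr-G2): the `σ_q`-target `H^{q+2}(A, Ω^q_A)` is finite-dimensional over `ℂ`,
# GIVEN the named fact «coherent cohomology of a proper scheme over a field is finite-dimensional»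

research route conditional on HC_CM; not a corollary; Q11.4-sentence-2 already refuted in dim ≥ 3.

Seat core-qb, plate (c1Tr-G2) (director-hodge g16 R16.27 (2)): input (G2) of core-w1's injectivity argument for the trace map `ρ_q`
of (c1Tr) `stub_tracePair` (crux stmt-HodgeConjecture-26512): `ρ_q ∘ g^♮ = (deg g) • id` on `H = H^{q+2}(A, Ω^q_A)` (G1) forces `ρ_q`
injective once `H` is a FINITE-DIMENSIONAL `ℂ`-vector space (G2). Here `H` is the (SC) chain's carrier
`sigmaTarget A.X q = Hom_{D(Mod 𝒪_A)}(Q 𝒪_A[0], (Q Ω^q_A[0])⟦q+2⟧)` (`Theorems/VHCAbelianSchemesRoadSigmaTransferDerivedLiftingDatum`).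

* `coh_hodgeSheaf A q` — `Ω^q_A` is coherent (finite locally free: `Crystalline.isFiniteLocallyFree_hodgeSheaf` for the smooth
  `A → Spec ℂ` of relative dimension `dim A`; `coh_of_isVectorBundle`). PROVED.
* **`module_finite_sigmaTarget`** — `Module.Finite ℂ (sigmaTarget A.X q)` for every complex abelian variety `A` and every `q`,
  GIVEN the named fact `Literature.AlgebraicGeometry.Morphisms.GortzWedhorn2023_cohomology_proper_coherent_finite` (Görtz–Wedhorn II
  Cor. 23.18, field case, on exactly this carrier; `A` is proper over `ℂ` by `AbelianVariety.isProper`). CONDITIONAL on that fact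
  (displayed as the hypothesis `hfin`; named-fact debt +1 on (c1Tr), director R16.27 (2)(b)).

Nothing here says (G1), (c1Tr), (c1), T′, 26512, №4, HC_AV or HC holds; HC_CM untouched. `--supports stmt-HodgeConjecture-26512 --as helper`;
closes no stub.

References: U. Görtz, T. Wedhorn, *Algebraic Geometry II* (2023), Cor. 23.18 [GortzWedhorn2023]; R.-O. Buchweitz, H. Flenner, Compositio
Math. 137 (2003), Def. 4.1 (the target of `σ_q`) [BuchweitzFlenner2003]; D. Mumford, *Abelian Varieties* (1970), §7 Thm. 4 [MumfordAV1970].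
-/

noncomputable section

set_option linter.dupNamespace false -- the cell's namespace repeats the summit name, as in every `Ring2*` file

open CategoryTheory AlgebraicGeometry

namespace Summit.HodgeConjecture.HodgeConjecture.Ring2.SemiregularRepresentatives

open Literature.AlgebraicGeometry Literature.AlgebraicGeometry.Modules Literature.AlgebraicGeometry.Motives
open Literature.AlgebraicGeometry.Motives.AbelianVariety Literature.AlgebraicGeometry.Morphisms

/-- **`Ω^q_A` is coherent** for a complex abelian variety `A` (finite locally free of rank `C(dim A, q)` since `A → Spec ℂ` is smooth of
relative dimension `dim A`; vector bundles are coherent). [cite: Hartshorne1977, II Ex. 5.16 (a) and II Thm. 8.15] -/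
theorem coh_hodgeSheaf (A : AbelianVariety ℂ) (q : ℕ) : Coh (hodgeSheaf A.X q) := by
  haveI := A.smoothOfRelativeDimension_dim
  exact coh_of_isVectorBundle
    (Literature.AlgebraicGeometry.Crystalline.isFiniteLocallyFree_hodgeSheaf A.X A.dim q).isVectorBundle

/-- **(G2) — the `σ_q`-target `H^{q+2}(A, Ω^q_A)` is a finite-dimensional `ℂ`-vector space**, GIVEN the named fact «coherent cohomology
of a proper scheme over a field is finite-dimensional» (Görtz–Wedhorn II Cor. 23.18, field case, on the derived-Hom carrier): instantiate it
at `X = A` (proper: `AbelianVariety.isProper`), `𝓕 = Ω^q_A` (coherent: `coh_hodgeSheaf`), `n = q + 2`. CONDITIONAL on `hfin`.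
[cite: GortzWedhorn2023, Cor. 23.18 (p. 425)] [cite: BuchweitzFlenner2003, Def. 4.1 (the target of σ_q)] -/
theorem module_finite_sigmaTarget (hfin : GortzWedhorn2023_cohomology_proper_coherent_finite) (A : AbelianVariety ℂ) (q : ℕ) :
    letI := HasDerivedCategory.standard A.X.left.Modules
    Module.Finite ℂ (sigmaTarget A.X q) := by
  letI := HasDerivedCategory.standard A.X.left.Modules
  exact hfin ℂ A.X (hodgeSheaf A.X q) (coh_hodgeSheaf A q) (q + 2)

/-- (G2) in the `FiniteDimensional` spelling core-w1's `rho_injective_of_split` (p653485) consumes: `H^{q+2}(A, Ω^q_A)` (the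
`σ_q`-target) is a finite-dimensional `ℂ`-vector space, GIVEN the named fact. [cite: GortzWedhorn2023, Cor. 23.18 (p. 425)] -/
theorem finiteDimensional_sigmaTarget (hfin : GortzWedhorn2023_cohomology_proper_coherent_finite) (A : AbelianVariety ℂ) (q : ℕ) :
    letI := HasDerivedCategory.standard A.X.left.Modules
    FiniteDimensional ℂ (sigmaTarget A.X q) :=
  module_finite_sigmaTarget hfin A q

end Summit.HodgeConjecture.HodgeConjecture.Ring2.SemiregularRepresentatives

end
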